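import Literature.NumberTheory.Automorphic.UnitaryOrbitalIntegralSimilitudeTransport   -- ★ B-p10 (g25): `formCongr_glDiagonal_one_eq_smul_placeForm_antidiag` (`D_ϖ = diag(1, ϖ)` is a similitude of `Φ₂`)
import Literature.NumberTheory.Automorphic.UnitaryGroupModularLocus                      -- ★ `formCongr_inv_eq_inv_smul_of_formCongr_eq_smul`, `unitaryGroupOfForm_smul_of_isUnit`, `GLn.conjEquiv`
import Literature.GroupTheory.CosetSpaceMulEquivCongr                                   -- ★ A-p16 p843403: `finsum_mem_fixedBy_quotient_congr_eq`, `exists_equiv_quotient_congr`, …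
import Literature.NumberTheory.Rogawski1990.CartanInvariant                              -- ★ `twistGram`, `twistGram_mul`
import HarnessLib

/-!
# Similitude transport of fixed-point sums on a unitary group: `Σ_{Fix_γ(U ⧸ K_{DSD⁻¹})} φ(q⁻¹γq) = Σ_{Fix_{D⁻¹γD}(U ⧸ K_S)} (φ∘Ad D)(p⁻¹·D⁻¹γD·p)`
# (Kottwitz 1988 §2; Rogawski 1990 §12.6: the `ϖ`-modular vertices of `U(1,1)` are `d⁻¹`-transports of the self-dual ones, `d = diag(1, ϖ)`)

Topic `NumberTheory/Automorphic`; namespace `Literature.NumberTheory.Automorphic`.  THEOREMS ONLY (no definition, no instance, no notation, no named fact, no `sorry`).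
Cell `pub/hodgecm-mathlib` (D-0151), crux H413 = `stmt-HodgeConjecture-24833`, road «R1LL-tree» (LEAD F0P3a-plan (g10); architect A-p16 (g27) RULING A-14 (b):
«(H4) `K¹` twin IS A TRANSPORT of (H3)», dealt to B-p10 (g26)).  FILE 1 of (H4): the GENERIC transport, no dependence on A-p13 (g31)'s (H3) `RankOneKappaOrbitalDepthExpansion`;
FILE 2 `Rogawski1990/RankOneKappaOrbitalDepthExpansionModular` plugs (H3) in.  HONEST LABEL: HC_CM is proved only modulo the printed citations (the 2 remaining named
inputs hLiu418, h413) until rung 0 closes; nothing printed is asserted here — this is group theory.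

THE MATHEMATICS.  `R` a commutative (topological) ring with `σ : R →+* R`, `H ∈ M_n(R)`, `U := U(σ, H) = unitaryGroupOfForm σ H ≤ GL_n(R)`.  A SIMILITUDE `D ∈ GL_n(R)`,
`ᵗ(σD) H D = a·H` with `a ∈ Rˣ`, normalises `U` (★ `conj_mem_unitaryGroupOfForm_iff` + ★ `unitaryGroupOfForm_smul_of_isUnit`), so **`e := Ad(D⁻¹) : U ≃ₜ* U`** (§1, delivered
EXISTENTIALLY with its two coe laws — no def lane).  For an ambient level `S ≤ GL_n(R)` put `K := S ∩ U` (`S.subgroupOf U`) and `K′ := DSD⁻¹ ∩ U` (`(S.map (MulAut.conj D)).subgroupOf U`);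
then `g ∈ K′ ↔ e g ∈ K` (§2), and ★ A-p16 `finsum_mem_fixedBy_quotient_congr_eq` gives, for `φ : U → E` invariant under `K′`-conjugation,
  **`Σᶠ_{q ∈ Fix_γ(U⧸K′)} φ(q.out⁻¹ γ q.out) = Σᶠ_{p ∈ Fix_{eγ}(U⧸K)} φ(e.symm(p.out⁻¹ (eγ) p.out))`** (§3), together with `#Fix` and finiteness.
§4 carries the (H3)-side data across `e`: an eigenframe `γP = P·diag(u)` becomes `(D⁻¹γD)(D⁻¹P) = (D⁻¹P)·diag(u)` (SAME `u`), and the Gram invariant picks up the multiplier,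
`twistGram σ H (D⁻¹P) = a⁻¹ • twistGram σ H P` — so when `log|a|` is ODD the parity bit of the frame FLIPS (`even_log_inv_mul_iff_not_even`).  §5 is the CM specialisation of
A-14 (b): at a non-split `w` with `σ_w ϖ = ϖ`, `D_ϖ := glDiagonal 2 L_w ![1, ϖ]` is a similitude of `(Φ₂)_w` with multiplier `ϖ` (★ B-p10 `formCongr_glDiagonal_one_eq_smul_placeForm_antidiag`),
on the LITERAL one-place carrier `↥(unitaryGroupOfForm (galAdicCompletionMap (L := L) (IsCMField.complexConj L) hw) (placeForm Φ₂ w.1))` (A-14 (a) pin), with `K⁰ = GL₂(𝒪_w) ∩ U`,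
`K¹ = D_ϖ GL₂(𝒪_w) D_ϖ⁻¹ ∩ U`; and the value-point rider `D_ϖ·(c(1 + t N_δ))·D_ϖ⁻¹ = c(1 + tϖ⁻¹ N_δ)` for `N_δ = [[0, δ],[0, 0]]`.

* §1 **`exists_continuousMulEquiv_coe_eq_conj`** (`e = Ad(D⁻¹)` on `↥U`, coe laws for `e` and `e.symm`).
* §2 `mem_subgroupOf_map_conj_iff` (`g ∈ K′ ↔ e g ∈ K`), `comp_symm_eq_zero_of` (support transport), `conj_invariant_comp_symm`, `mul_invariant_comp_symm`.
* §3 **`finsum_fixedBy_quotient_mapConj_eq`**, `ncard_fixedBy_quotient_mapConj_eq`, `finite_fixedBy_quotient_mapConj_iff`.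
* §4 `coe_conj_mul_eq_mul_diagonal` (eigenframe transport), **`twistGram_coe_inv_mul_eq_inv_smul`** (+ `_apply`), `even_log_inv_mul_iff_not_even` (parity flip).
* §5 **`exists_continuousMulEquiv_modular`** (CM, `D_ϖ`), `diagonal_mul_smul_one_add_mul_diagonal_inv` (value-point rider), `coe_glDiagonal_one_eq`.

## References
* [Kottwitz1988] R. E. Kottwitz, *Tamagawa numbers*, Ann. of Math. 127 (1988): §2 (Euler–Poincaré functions; fixed points of `γ` on `G ⧸ K` and on `G ⧸ K′`).
* [Rogawski1990] J. D. Rogawski, *Automorphic Representations of Unitary Groups in Three Variables* (1990): §12.6 p. 174 (the two vertex stabilisers of `U(1,1)`), §4.9 Lemma 4.9.3 p. 56.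
* [Kottwitz1986] R. E. Kottwitz, *Base change for unit elements of Hecke algebras*, Compositio Math. 60 (1986): §3.
* [BourbakiAlgebraI1989] N. Bourbaki, *Algebra I* (1989): Ch. I §5 no. 5 (transport of structure for homogeneous spaces).
-/

set_option autoImplicit false

noncomputable section

open MulAction NumberField IsDedekindDomain
open scoped Matrix MatrixGroups

namespace Literature.NumberTheory.Automorphic

open Literature.NumberTheory.Rogawski1990 (twistGram twistGram_def twistGram_mul)

/-! ## §1 The similitude `D` normalises `U(σ, H)`: `e = Ad(D⁻¹) : U ≃ₜ* U` -/

section Generic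

variable {R : Type*} [CommRing R] [TopologicalSpace R] [IsTopologicalRing R] {n : ℕ} (σ : R →+* R) (H : Matrix (Fin n) (Fin n) R)
  (D : GL (Fin n) R) {a : R}

/-- **`Ad(D⁻¹)` IS A TOPOLOGICAL AUTOMORPHISM OF `U(σ, H)`** for a similitude `D` (`ᵗ(σD) H D = a·H`, `a ∈ Rˣ`): `D⁻¹ g D ∈ U(H) ⟺ g ∈ U(ᵗ(σD⁻¹)HD⁻¹) = U(a⁻¹H) = U(H)`.
Delivered existentially with its coe laws (`↑(e g) = D⁻¹ g D`, `↑(e.symm g) = D g D⁻¹`). [cite: Kottwitz1988, §2] [cite: Rogawski1990, §12.6 p. 174] -/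
theorem exists_continuousMulEquiv_coe_eq_conj (ha : IsUnit a) (hD : formCongr σ D H = a • H) :
    ∃ e : ↥(unitaryGroupOfForm σ H) ≃ₜ* ↥(unitaryGroupOfForm σ H),
      (∀ g, ((e g : ↥(unitaryGroupOfForm σ H)) : GL (Fin n) R) = D⁻¹ * g * D) ∧
      ∀ g, ((e.symm g : ↥(unitaryGroupOfForm σ H)) : GL (Fin n) R) = D * g * D⁻¹ := by
  have hD' : formCongr σ D H = ((ha.unit : Rˣ) : R) • H := by rw [IsUnit.unit_spec]; exact hD
  have hDinv : formCongr σ D⁻¹ H = ((ha.unit⁻¹ : Rˣ) : R) • H := UnitaryGroup.formCongr_inv_eq_inv_smul_of_formCongr_eq_smul σ D H hD'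
  have hmem : ∀ g : GL (Fin n) R, g ∈ unitaryGroupOfForm σ H ↔ GLn.conjEquiv D⁻¹ g ∈ unitaryGroupOfForm σ H := by
    intro g
    rw [GLn.conjEquiv_apply, conj_mem_unitaryGroupOfForm_iff, hDinv, unitaryGroupOfForm_smul_of_isUnit σ (ha.unit⁻¹).isUnit]
  refine ⟨ContinuousMulEquiv.restrictSubgroup (GLn.conjEquiv D⁻¹) _ _ hmem, fun g => ?_, fun g => ?_⟩
  · rw [ContinuousMulEquiv.coe_restrictSubgroup_apply, GLn.conjEquiv_apply, inv_inv]
  · rw [ContinuousMulEquiv.coe_restrictSubgroup_symm_apply]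
    have h : GLn.conjEquiv D⁻¹ (D * (g : GL (Fin n) R) * D⁻¹) = g := by rw [GLn.conjEquiv_apply]; group
    conv_lhs => rw [← h, ContinuousMulEquiv.symm_apply_apply]

/-! ## §2 Levels and test functions across `e` -/

variable {σ H D}
variable (e : ↥(unitaryGroupOfForm σ H) ≃ₜ* ↥(unitaryGroupOfForm σ H)) (he : ∀ g, ((e g : ↥(unitaryGroupOfForm σ H)) : GL (Fin n) R) = D⁻¹ * g * D)

omit [IsTopologicalRing R] in
include he in
/-- **`g ∈ K′ ↔ e g ∈ K`** for `K = S ∩ U`, `K′ = DSD⁻¹ ∩ U`: `↑g ∈ DSD⁻¹ ⟺ D⁻¹ ↑g D ∈ S`. [cite: Kottwitz1988, §2] -/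
theorem mem_subgroupOf_map_conj_iff (S : Subgroup (GL (Fin n) R)) (g : ↥(unitaryGroupOfForm σ H)) :
    g ∈ (S.map (MulAut.conj D).toMonoidHom).subgroupOf (unitaryGroupOfForm σ H) ↔ e g ∈ S.subgroupOf (unitaryGroupOfForm σ H) := by
  rw [Subgroup.mem_subgroupOf, Subgroup.mem_subgroupOf, he, Subgroup.mem_map_equiv, MulAut.conj_symm_apply]

omit [IsTopologicalRing R] in
/-- **Support transport**: if `φ` vanishes off `K′` then `φ ∘ e.symm` vanishes off `K` (for ANY pair of subsets with `g ∈ K′ ↔ e g ∈ K`). [cite: Kottwitz1988, §2] -/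
theorem comp_symm_eq_zero_of {E : Type*} [Zero E] {K K' : Set ↥(unitaryGroupOfForm σ H)} (hK : ∀ g, g ∈ K' ↔ e g ∈ K)
    (φ : ↥(unitaryGroupOfForm σ H) → E) (hφ : ∀ g ∉ K', φ g = 0) : ∀ g ∉ K, (φ ∘ e.symm) g = 0 := by
  intro g hg
  exact hφ _ fun h => hg (by simpa using (hK _).1 h)

omit [IsTopologicalRing R] in
/-- **Conjugation invariance transports**: `φ` invariant under `K′`-conjugation ⇒ `φ ∘ e.symm` invariant under `K`-conjugation (any pair `g ∈ K′ ↔ e g ∈ K`). [cite: Kottwitz1986, §3] -/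
theorem conj_invariant_comp_symm {E : Type*} {K K' : Subgroup ↥(unitaryGroupOfForm σ H)} (hK : ∀ g, g ∈ K' ↔ e g ∈ K)
    (φ : ↥(unitaryGroupOfForm σ H) → E) (hφ : ∀ k ∈ K', ∀ x, φ (k * x * k⁻¹) = φ x) :
    ∀ k ∈ K, ∀ x, (φ ∘ e.symm) (k * x * k⁻¹) = (φ ∘ e.symm) x := by
  intro k hk x
  simp only [Function.comp_apply, map_mul, map_inv]
  exact hφ _ ((hK _).2 (by simpa using hk)) _

omit [IsTopologicalRing R] in
/-- **Right invariance transports**: `φ` right-invariant under `M′` ⇒ `φ ∘ e.symm` right-invariant under `M` (any pair `g ∈ M′ ↔ e g ∈ M`; in use `M′ = Ad(D)(K_m)`, the level-`m`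
subgroup of `K′`). [cite: Kottwitz1986, §3] -/
theorem mul_invariant_comp_symm {E : Type*} {M M' : Set ↥(unitaryGroupOfForm σ H)} (hM : ∀ g, g ∈ M' ↔ e g ∈ M)
    (φ : ↥(unitaryGroupOfForm σ H) → E) (hφ : ∀ x, ∀ y ∈ M', φ (x * y) = φ x) :
    ∀ x, ∀ y ∈ M, (φ ∘ e.symm) (x * y) = (φ ∘ e.symm) x := by
  intro x y hy
  simp only [Function.comp_apply, map_mul]
  exact hφ _ _ ((hM _).2 (by simpa using hy))

/-! ## §3 Fixed-point sums, counts and finiteness across `e` -/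

omit [IsTopologicalRing R] in
include he in
/-- **FIXED-POINT SUMS ACROSS THE SIMILITUDE** (★ A-p16 `finsum_mem_fixedBy_quotient_congr_eq` with `f′ := φ ∘ e.symm`): for `φ : U → E` invariant under `K′`-conjugation,
`Σᶠ_{q ∈ Fix_γ(U⧸K′)} φ(q.out⁻¹ γ q.out) = Σᶠ_{p ∈ Fix_{eγ}(U⧸K)} φ(e.symm(p.out⁻¹ (eγ) p.out))` — the number∕weights of `γ`-fixed `DSD⁻¹`-cosets read through `Ad(D⁻¹)`.
[cite: Kottwitz1988, §2] [cite: Rogawski1990, §12.6 p. 174] [cite: Kottwitz1986, §3] -/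
theorem finsum_fixedBy_quotient_mapConj_eq {E : Type*} [AddCommMonoid E] (S : Subgroup (GL (Fin n) R)) (γ : ↥(unitaryGroupOfForm σ H))
    (φ : ↥(unitaryGroupOfForm σ H) → E) (hφ : ∀ k ∈ (S.map (MulAut.conj D).toMonoidHom).subgroupOf (unitaryGroupOfForm σ H), ∀ x, φ (k * x * k⁻¹) = φ x) :
    ∑ᶠ q ∈ fixedBy (↥(unitaryGroupOfForm σ H) ⧸ (S.map (MulAut.conj D).toMonoidHom).subgroupOf (unitaryGroupOfForm σ H)) γ, φ (q.out⁻¹ * γ * q.out) =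
      ∑ᶠ p ∈ fixedBy (↥(unitaryGroupOfForm σ H) ⧸ S.subgroupOf (unitaryGroupOfForm σ H)) (e γ), φ (e.symm (p.out⁻¹ * e γ * p.out)) := by
  have hK := fun g => mem_subgroupOf_map_conj_iff e he S g
  have hcoe : ∀ x, e.toMulEquiv x = e x := fun _ => rfl
  have h := Literature.GroupTheory.finsum_mem_fixedBy_quotient_congr_eq ((S.map (MulAut.conj D).toMonoidHom).subgroupOf (unitaryGroupOfForm σ H))
    (S.subgroupOf (unitaryGroupOfForm σ H)) e.toMulEquiv hK (φ ∘ e.symm) (conj_invariant_comp_symm e hK φ hφ) γ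
  simp only [Function.comp_apply, hcoe, ContinuousMulEquiv.symm_apply_apply] at h
  exact h

omit [IsTopologicalRing R] in
include he in
/-- **`#Fix_γ(U⧸K′) = #Fix_{eγ}(U⧸K)`** (as `Set.ncard`). [cite: Kottwitz1988, §2] [cite: Rogawski1990, §12.6 p. 174] -/
theorem ncard_fixedBy_quotient_mapConj_eq (S : Subgroup (GL (Fin n) R)) (γ : ↥(unitaryGroupOfForm σ H)) :
    (fixedBy (↥(unitaryGroupOfForm σ H) ⧸ (S.map (MulAut.conj D).toMonoidHom).subgroupOf (unitaryGroupOfForm σ H)) γ).ncard =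
      (fixedBy (↥(unitaryGroupOfForm σ H) ⧸ S.subgroupOf (unitaryGroupOfForm σ H)) (e γ)).ncard := by
  have hK := fun g => mem_subgroupOf_map_conj_iff e he S g
  have hcoe : ∀ x, e.toMulEquiv x = e x := fun _ => rfl
  obtain ⟨Ψ, -, hΨ⟩ := Literature.GroupTheory.exists_equiv_quotient_congr ((S.map (MulAut.conj D).toMonoidHom).subgroupOf (unitaryGroupOfForm σ H))
    (S.subgroupOf (unitaryGroupOfForm σ H)) e.toMulEquiv hK
  rw [← hcoe, ← Literature.GroupTheory.image_fixedBy_quotient_congr_eq _ _ e.toMulEquiv Ψ hΨ γ, Set.ncard_image_of_injective _ Ψ.injective]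

omit [IsTopologicalRing R] in
include he in
/-- **Finiteness transports**: `Fix_γ(U⧸K′)` is finite iff `Fix_{eγ}(U⧸K)` is. [cite: Kottwitz1988, §2] -/
theorem finite_fixedBy_quotient_mapConj_iff (S : Subgroup (GL (Fin n) R)) (γ : ↥(unitaryGroupOfForm σ H)) :
    (fixedBy (↥(unitaryGroupOfForm σ H) ⧸ (S.map (MulAut.conj D).toMonoidHom).subgroupOf (unitaryGroupOfForm σ H)) γ).Finite ↔
      (fixedBy (↥(unitaryGroupOfForm σ H) ⧸ S.subgroupOf (unitaryGroupOfForm σ H)) (e γ)).Finite := by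
  have hK := fun g => mem_subgroupOf_map_conj_iff e he S g
  have hcoe : ∀ x, e.toMulEquiv x = e x := fun _ => rfl
  obtain ⟨Ψ, -, hΨ⟩ := Literature.GroupTheory.exists_equiv_quotient_congr ((S.map (MulAut.conj D).toMonoidHom).subgroupOf (unitaryGroupOfForm σ H))
    (S.subgroupOf (unitaryGroupOfForm σ H)) e.toMulEquiv hK
  rw [← hcoe, ← Literature.GroupTheory.image_fixedBy_quotient_congr_eq _ _ e.toMulEquiv Ψ hΨ γ, Set.finite_image_iff Ψ.injective.injOn]

/-! ## §4 Eigenframes and the Gram invariant across `e` -/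

omit [TopologicalSpace R] [IsTopologicalRing R] in
/-- **The eigenframe transports with the SAME eigenvalues**: `γP = P·diag(u)` ⇒ `(D⁻¹γD)(D⁻¹P) = (D⁻¹P)·diag(u)`. [cite: Rogawski1990, §12.6 p. 174] -/
theorem coe_conj_mul_eq_mul_diagonal (γ P : GL (Fin n) R) {u : Fin n → R}
    (hP : (γ : Matrix (Fin n) (Fin n) R) * P = P * Matrix.diagonal u) :
    ((D⁻¹ * γ * D : GL (Fin n) R) : Matrix (Fin n) (Fin n) R) * ((D⁻¹ * P : GL (Fin n) R) : Matrix (Fin n) (Fin n) R) =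
      ((D⁻¹ * P : GL (Fin n) R) : Matrix (Fin n) (Fin n) R) * Matrix.diagonal u := by
  have hDD : ((D : GL (Fin n) R) : Matrix (Fin n) (Fin n) R) * ((D⁻¹ : GL (Fin n) R) : Matrix (Fin n) (Fin n) R) = 1 := by
    rw [← Units.val_mul, mul_inv_cancel, Units.val_one]
  simp only [Units.val_mul]
  calc ((D⁻¹ : GL (Fin n) R) : Matrix (Fin n) (Fin n) R) * γ * D * (((D⁻¹ : GL (Fin n) R) : Matrix (Fin n) (Fin n) R) * P)
      = ((D⁻¹ : GL (Fin n) R) : Matrix (Fin n) (Fin n) R) * γ * ((D : Matrix (Fin n) (Fin n) R) * ((D⁻¹ : GL (Fin n) R) : Matrix (Fin n) (Fin n) R)) * P := by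
        simp only [Matrix.mul_assoc]
    _ = ((D⁻¹ : GL (Fin n) R) : Matrix (Fin n) (Fin n) R) * ((γ : Matrix (Fin n) (Fin n) R) * P) := by rw [hDD, Matrix.mul_one, Matrix.mul_assoc]
    _ = ((D⁻¹ : GL (Fin n) R) : Matrix (Fin n) (Fin n) R) * P * Matrix.diagonal u := by rw [hP, Matrix.mul_assoc]

omit [TopologicalSpace R] [IsTopologicalRing R] in
/-- **THE GRAM INVARIANT PICKS UP THE MULTIPLIER**: `twistGram σ H (D⁻¹P) = a⁻¹ • twistGram σ H P` for a similitude `D` with `ᵗ(σD)HD = a·H` (so the frame `D⁻¹P` of the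
transported element has its `⟨p₀, p₀⟩` scaled by `a⁻¹` — the PARITY BIT FLIPS when `log|a|` is odd). [cite: Rogawski1990, §3.1 p. 19; §12.6 p. 174] -/
theorem twistGram_coe_inv_mul_eq_inv_smul (ha : IsUnit a) (hD : formCongr σ D H = a • H) (P : Matrix (Fin n) (Fin n) R) :
    twistGram σ H (((D⁻¹ : GL (Fin n) R) : Matrix (Fin n) (Fin n) R) * P) = ((ha.unit⁻¹ : Rˣ) : R) • twistGram σ H P := by
  have hD' : formCongr σ D H = ((ha.unit : Rˣ) : R) • H := by rw [IsUnit.unit_spec]; exact hD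
  have hDinv : twistGram σ H ((D⁻¹ : GL (Fin n) R) : Matrix (Fin n) (Fin n) R) = ((ha.unit⁻¹ : Rˣ) : R) • H :=
    UnitaryGroup.formCongr_inv_eq_inv_smul_of_formCongr_eq_smul σ D H hD'
  rw [twistGram_mul, hDinv, twistGram_def, Matrix.mul_smul, Matrix.smul_mul]

omit [TopologicalSpace R] [IsTopologicalRing R] in
/-- Entrywise form of `twistGram_coe_inv_mul_eq_inv_smul`: `twistGram σ H (D⁻¹P) i j = a⁻¹ · twistGram σ H P i j`. [cite: Rogawski1990, §3.1 p. 19] -/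
theorem twistGram_coe_inv_mul_apply (ha : IsUnit a) (hD : formCongr σ D H = a • H) (P : Matrix (Fin n) (Fin n) R) (i j : Fin n) :
    twistGram σ H (((D⁻¹ : GL (Fin n) R) : Matrix (Fin n) (Fin n) R) * P) i j = ((ha.unit⁻¹ : Rˣ) : R) * twistGram σ H P i j := by
  rw [twistGram_coe_inv_mul_eq_inv_smul ha hD P, Matrix.smul_apply, smul_eq_mul]

end Generic

/-- **PARITY FLIP**: in a valued field with value group `ℤₘ₀`, if `log|a|` is odd then `log|a⁻¹x|` is even iff `log|x|` is not (`x ≠ 0`). (With `a = ϖ` a uniformizer of `L_w`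
at an unramified `w`: the type of the vertex fixed by the torus flips under `Ad(D_ϖ⁻¹)`, `e ↦ 1 − e`.) [cite: Rogawski1990, §12.6 p. 174] -/
theorem even_log_inv_mul_iff_not_even {K : Type*} [Field K] [Valued K (WithZero (Multiplicative ℤ))] {a x : K} (ha : a ≠ 0) (hx : x ≠ 0)
    (hodd : Odd (WithZero.log (Valued.v a))) :
    Even (WithZero.log (Valued.v (a⁻¹ * x))) ↔ ¬ Even (WithZero.log (Valued.v x)) := by
  have hva : Valued.v a ≠ 0 := (Valuation.ne_zero_iff _).2 ha
  have hvx : Valued.v x ≠ 0 := (Valuation.ne_zero_iff _).2 hx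
  rw [Valuation.map_mul, Valuation.map_inv, WithZero.log_mul (inv_ne_zero hva) hvx, WithZero.log_inv, Int.even_add, even_neg]
  have hna : ¬ Even (WithZero.log (Valued.v a)) := Int.not_even_iff_odd.2 hodd
  constructor
  · intro h hx'
    exact hna (h.2 hx')
  · intro h
    exact ⟨fun ha' => absurd ha' hna, fun hx' => absurd hx' h⟩

/-! ## §5 The CM one-place model: `D_ϖ = diag(1, ϖ)` on `U(σ_w, (Φ₂)_w)`, `K⁰ = GL₂(𝒪_w) ∩ U`, `K¹ = D_ϖ GL₂(𝒪_w) D_ϖ⁻¹ ∩ U` -/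

section CM

variable (L : Type) [Field L] [NumberField L] [IsCMField L] {v : HeightOneSpectrum (𝓞 ↥(maximalRealSubfield L))}
  (w : UnitaryGroup.PlacesOver L v) (hw : IsCMField.complexConj L • w.1 = w.1)

/-- **`e_ϖ = Ad(D_ϖ⁻¹)` ON THE ONE-PLACE GROUP `U = U(σ_w, (Φ₂)_w)(L_w)`** (literal carrier of A-14 (a)), `D_ϖ = glDiagonal 2 L_w ![1, ϖ]` for a `σ_w`-fixed unit `ϖ`
(★ B-p10 `formCongr_glDiagonal_one_eq_smul_placeForm_antidiag`: `ᵗ(σ_w D_ϖ)(Φ₂)_w D_ϖ = ϖ·(Φ₂)_w`): coe laws and, for EVERY ambient level `S ≤ GL₂(L_w)`,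
`g ∈ (D_ϖ S D_ϖ⁻¹) ∩ U ↔ e_ϖ g ∈ S ∩ U` — with `S = GL₂(𝒪_w)`: `K¹ ↔ K⁰`, the `ϖ`-modular and the self-dual vertex stabilisers. [cite: Kottwitz1988, §2]
[cite: Rogawski1990, §12.6 p. 174] -/
theorem exists_continuousMulEquiv_modular (ϖ : (w.1.adicCompletion L)ˣ)
    (hσϖ : galAdicCompletionMap (L := L) (IsCMField.complexConj L) hw (ϖ : w.1.adicCompletion L) = ϖ) :
    ∃ e : ↥(unitaryGroupOfForm (galAdicCompletionMap (L := L) (IsCMField.complexConj L) hw)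
          (UnitaryGroup.placeForm (Matrix.of fun i j : Fin 2 => if i.val + j.val + 1 = 2 then (1 : L) else 0) w.1)) ≃ₜ*
        ↥(unitaryGroupOfForm (galAdicCompletionMap (L := L) (IsCMField.complexConj L) hw)
          (UnitaryGroup.placeForm (Matrix.of fun i j : Fin 2 => if i.val + j.val + 1 = 2 then (1 : L) else 0) w.1)),
      (∀ g, ((e g : ↥(unitaryGroupOfForm (galAdicCompletionMap (L := L) (IsCMField.complexConj L) hw)
          (UnitaryGroup.placeForm (Matrix.of fun i j : Fin 2 => if i.val + j.val + 1 = 2 then (1 : L) else 0) w.1))) : GL (Fin 2) (w.1.adicCompletion L)) =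
        (glDiagonal 2 (w.1.adicCompletion L) ![1, ϖ])⁻¹ * g * glDiagonal 2 (w.1.adicCompletion L) ![1, ϖ]) ∧
      (∀ g, ((e.symm g : ↥(unitaryGroupOfForm (galAdicCompletionMap (L := L) (IsCMField.complexConj L) hw)
          (UnitaryGroup.placeForm (Matrix.of fun i j : Fin 2 => if i.val + j.val + 1 = 2 then (1 : L) else 0) w.1))) : GL (Fin 2) (w.1.adicCompletion L)) =
        glDiagonal 2 (w.1.adicCompletion L) ![1, ϖ] * g * (glDiagonal 2 (w.1.adicCompletion L) ![1, ϖ])⁻¹) ∧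
      ∀ (S : Subgroup (GL (Fin 2) (w.1.adicCompletion L))) g,
        g ∈ (S.map (MulAut.conj (glDiagonal 2 (w.1.adicCompletion L) ![1, ϖ])).toMonoidHom).subgroupOf _ ↔ e g ∈ S.subgroupOf _ := by
  obtain ⟨e, he, hes⟩ := exists_continuousMulEquiv_coe_eq_conj (galAdicCompletionMap (L := L) (IsCMField.complexConj L) hw)
    (UnitaryGroup.placeForm (Matrix.of fun i j : Fin 2 => if i.val + j.val + 1 = 2 then (1 : L) else 0) w.1)
    (glDiagonal 2 (w.1.adicCompletion L) ![1, ϖ]) ϖ.isUnit (UnitaryGroup.formCongr_glDiagonal_one_eq_smul_placeForm_antidiag L w hw ϖ hσϖ)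
  exact ⟨e, he, hes, fun S g => mem_subgroupOf_map_conj_iff e he S g⟩

omit [NumberField L] [IsCMField L] in
/-- **VALUE-POINT RIDER**: `diag(1, ϖ)·(c·(1 + t·N_δ))·diag(1, ϖ⁻¹) = c·(1 + tϖ⁻¹·N_δ)` for `N_δ = [[0, δ],[0, 0]]` — the (H3) value points `u₁·(1 + ϖ^i N_δ)` read in `K¹`
become `u₁·(1 + ϖ^{i−1}… )`, precisely `u₁·(1 + ϖ^iϖ⁻¹ N_δ)`. [cite: Rogawski1990, §12.6 p. 174] -/
theorem diagonal_mul_smul_one_add_mul_diagonal_inv {K : Type*} [Field K] (ϖ : K) (hϖ : ϖ ≠ 0) (c t δ : K) :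
    !![(1 : K), 0; 0, ϖ] * (c • ((1 : Matrix (Fin 2) (Fin 2) K) + t • !![0, δ; 0, 0])) * !![(1 : K), 0; 0, ϖ⁻¹] =
      c • ((1 : Matrix (Fin 2) (Fin 2) K) + (t * ϖ⁻¹) • !![0, δ; 0, 0]) := by
  ext i j
  fin_cases i <;> fin_cases j <;> simp [Matrix.one_fin_two, Matrix.mul_apply, Fin.sum_univ_two] <;> field_simp

/-- `↑(glDiagonal 2 K ![1, ϖ]) = !![1, 0; 0, ϖ]` and `↑(glDiagonal 2 K ![1, ϖ])⁻¹ = !![1, 0; 0, ϖ⁻¹]` (to read `exists_continuousMulEquiv_modular`'s coe laws as matrices).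
[cite: Rogawski1990, §12.6 p. 174] -/
theorem coe_glDiagonal_one_eq {K : Type*} [Field K] (ϖ : Kˣ) :
    ((glDiagonal 2 K ![1, ϖ] : GL (Fin 2) K) : Matrix (Fin 2) (Fin 2) K) = !![(1 : K), 0; 0, (ϖ : K)] ∧
      (((glDiagonal 2 K ![1, ϖ])⁻¹ : GL (Fin 2) K) : Matrix (Fin 2) (Fin 2) K) = !![(1 : K), 0; 0, ((ϖ⁻¹ : Kˣ) : K)] := by
  have h1 : ((glDiagonal 2 K ![1, ϖ] : GL (Fin 2) K) : Matrix (Fin 2) (Fin 2) K) = !![(1 : K), 0; 0, (ϖ : K)] := by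
    rw [coe_glDiagonal]
    ext i j
    fin_cases i <;> fin_cases j <;> simp
  refine ⟨h1, ?_⟩
  rw [← map_inv, show (![1, ϖ] : Fin 2 → Kˣ)⁻¹ = ![1, ϖ⁻¹] from funext fun i => by fin_cases i <;> simp, coe_glDiagonal]
  ext i j
  fin_cases i <;> fin_cases j <;> simp

end CM

end Literature.NumberTheory.Automorphic

end
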